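import Summits.CriticalPhenomena.PercolationContinuityZ3.Theorems.PercNearOneGluingNoHeavyLowerTailSahiCombPositivity
import Summits.CriticalPhenomena.PercolationContinuityZ3.Theorems.PercNearOneGluingNoHeavyLowerTailSahiDefectExpansion
import Literature.Combinatorics.Sahi2008.Symmetry
import HarnessLib

/-!
# Sahi positivity under mixtures (law level), I: the MIXTURE CONJECTURE typed, Bernstein positivity in the mixing weight,
# and RANGE LIFTING — for every finite family of events the conjecture reduces to its square-free cells

Support file of the one-cut programme (crux `NoHeavyLowerTail`, stmt-CriticalPhenomena-4575; cell `prim-masterthm`, seat P3, gen 5;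
`run/shared/lean/prim/prim-masterthm/prim-masterthm-p3/HIERARCHY.md` §11–§12).  Companion: `…SahiMixtureLawThree` (the conjecture for three
events is a THEOREM), `…SahiMixtureThreeCell` (gen 4: the one cell that needs a genuine certificate, replayed from ttrl cp-mix).

SETTING.  A probability weight `μ` on a finite type `α`, events `A_0,…,A_{n−1} ⊆ α`, and an INDEPENDENT coin of bias `h`: the product
weight `coinWeight μ h` on `α × Bool` (`(a, ξ) ↦ μ(a)·(h if ξ else 1−h)`).  OR-ing the coin event `{ξ}` into the members `A_i`, `F i = true`,
gives the events `orCoin (A i) (F i) = {(a,ξ) | a ∈ A_i ∨ (F i ∧ ξ)}`; AND-ing it gives `andCoin (A i) (F i) = {(a,ξ) | a ∈ A_i ∧ (F i → ξ)}`.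
For a slot map `s : Fin m → Fin n` (a MULTISET of members), `h ↦ E_m(coinWeight μ h; 1_{B_{s 0}},…,1_{B_{s (m−1)}})` is a polynomial of
degree `≤ m` in `h`.

* `BernsteinPos m Φ` — `Φ` agrees on `[0,1]` with a NONNEGATIVE combination of `h^j (1−h)^{m−j}`, `j ≤ m` (:= `SahiComb.CombPos` over the
  one-point index type; closure under `+`, nonnegative scalars, products (degrees add), degree elevation; affine functions with nonnegative
  endpoint values; `BernsteinPos.nonneg`).
* **`MixtureBernsteinPositivity`** (`@[conjecture]`, this seat gen 4, HIERARCHY §11 UPDATE; census ttrl cp-mix lane `mix`: n = 3 exhaustive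
  on the grids of denominator 12 and 20 — 7 044 856 + 103 658 464 (w,F,s,kind) tests, 0 negative Bernstein coefficients): if the family `A` is
  Sahi-nonnegative at EVERY order (all multisets), then for every `F` and every multiset `s`, the OR-mixture AND the AND-mixture functionals
  `h ↦ E_m(coinWeight μ h; …)` are `BernsteinPos m`.  Consequences if true (HIERARCHY §11): all-orders Sahi positivity of the coverage
  indicators of every finite Boolean model (every family of OR-events / unions of independent events under product measures), of every
  "caterpillar" family, Sahi's Theorem 2.  OPEN; never import it as a fact.
* **`bernsteinPos_sahiE_of_injective` — RANGE LIFTING (law level, THEOREM)**: for ANY events `B_0,…,B_{n−1}` of `α × Bool`, if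
  `h ↦ E_m(coinWeight μ h; 1_{B∘s})` is `BernsteinPos m` for every INJECTIVE `s` (square-free cells, `m ≤ n`), then it is for every `s`.
  Proof: a repeated member contains the intersection of all the others, so the defect expansion of `…SahiDefectExpansion` (seat P5; any weight)
  writes `E_m` as a nonnegative combination of products of coin-moments of nonnegative functions (affine in `h`, nonnegative at `h = 0, 1`)
  and lower-order functionals of sub-multisets; strong induction on `m`.  Hence (`mixtureBernsteinPositivity_iff_squarefree`) the conjecture
  for `n` events is equivalent to its finitely many SQUARE-FREE cells `s : Fin m ↪ Fin n`; given the cells of `n − 1` events only the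
  `m = n` cells are new — `(n−1)` sizes of `F ∩ s` times `(n−1)` middle Bernstein coefficients, polynomial inequalities on the basic
  semialgebraic set `K_n` cut out by the `2^n − n − 1` square-free rows.  For `n = 3` all of them are closed (`…SahiMixtureLawThree`).
HONEST FRAMING: the conjecture is open for `n ≥ 4`; nothing general is claimed. [this work]
-/

noncomputable section

open scoped Classical

namespace Summit.CriticalPhenomena.PercolationContinuityZ3.Theorems

open Finset Function
open scoped Nat
open Literature.Combinatorics.Sahi2008
open Literature.Probability.Percolation.DecisionTree (ind ind_of_mem ind_of_not_mem ind_nonneg)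
open SahiComb

namespace SahiMixture

/-! ### Bernstein positivity of a function of the mixing weight -/

/-- `Φ : ℝ → ℝ` is **Bernstein-positive of degree `m`** on `[0,1]`: `Φ(h) = Σ_{j ≤ m} N_j h^j (1−h)^{m−j}` there with all `N_j ≥ 0`
(:= comb positivity over the one-point index type, `SahiComb.CombPos`). [this work] -/
def BernsteinPos (m : ℕ) (Φ : ℝ → ℝ) : Prop :=
  CombPos (fun _ : Unit => m) (fun p : Unit → unitInterval => Φ (p ()))

namespace BernsteinPos

variable {m a b : ℕ} {Φ Ψ : ℝ → ℝ}

/-- A Bernstein-positive function is nonnegative on `[0,1]`. [this work] -/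
theorem nonneg (hΦ : BernsteinPos m Φ) {h : ℝ} (h0 : 0 ≤ h) (h1 : h ≤ 1) : 0 ≤ Φ h :=
  CombPos.nonneg hΦ (fun _ => ⟨h, ⟨h0, h1⟩⟩)

/-- Transport along an identity valid on `[0,1]`. [this work] -/
theorem congr (hΦ : BernsteinPos m Φ) (hΨ : ∀ h : ℝ, 0 ≤ h → h ≤ 1 → Ψ h = Φ h) : BernsteinPos m Ψ :=
  CombPos.congr hΦ fun p => hΨ _ (p ()).2.1 (p ()).2.2

/-- Sums. [this work] -/
theorem add (hΦ : BernsteinPos m Φ) (hΨ : BernsteinPos m Ψ) : BernsteinPos m (fun h => Φ h + Ψ h) :=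
  CombPos.add hΦ hΨ

/-- Nonnegative scalar multiples. [this work] -/
theorem smul (hΦ : BernsteinPos m Φ) {c : ℝ} (hc : 0 ≤ c) : BernsteinPos m (fun h => c * Φ h) :=
  CombPos.smul hΦ hc

/-- Products: degrees add. [this work] -/
theorem mul (hΦ : BernsteinPos a Φ) (hΨ : BernsteinPos b Ψ) : BernsteinPos (a + b) (fun h => Φ h * Ψ h) :=
  CombPos.mul_of_eq hΦ hΨ (funext fun _ => rfl)

/-- Products, target degree up to `≤`. [this work] -/
theorem mul_of_le (hΦ : BernsteinPos a Φ) (hΨ : BernsteinPos b Ψ) (hm : a + b ≤ m) :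
    BernsteinPos m (fun h => Φ h * Ψ h) :=
  CombPos.mul_of_le hΦ hΨ fun _ => hm

/-- Degree elevation. [this work] -/
theorem mono (hΦ : BernsteinPos a Φ) (hab : a ≤ b) : BernsteinPos b Φ :=
  CombPos.mono hΦ fun _ => hab

/-- Finite sums. [this work] -/
theorem sum {κ : Type*} (S : Finset κ) {Φ : κ → ℝ → ℝ} (hΦ : ∀ k ∈ S, BernsteinPos m (Φ k)) :
    BernsteinPos m (fun h => ∑ k ∈ S, Φ k h) :=
  CombPos.sum S hΦ

end BernsteinPos

/-- Nonnegative constants are Bernstein-positive of every degree. [folklore] -/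
theorem bernsteinPos_const (m : ℕ) {c : ℝ} (hc : 0 ≤ c) : BernsteinPos m (fun _ => c) :=
  combPos_const _ hc

/-- `h ↦ 1 − h` is Bernstein-positive of degree `1`. [folklore] -/
theorem bernsteinPos_one_sub : BernsteinPos 1 (fun h => 1 - h) := by
  unfold BernsteinPos
  convert combPos_one_sub_coord (ι := Unit) () using 2
  rename_i u; cases u; simp

/-- `h ↦ h` is Bernstein-positive of degree `1`. [folklore] -/
theorem bernsteinPos_id : BernsteinPos 1 (fun h => h) := by
  unfold BernsteinPos
  convert combPos_coord (ι := Unit) () using 2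
  rename_i u; cases u; simp

/-- **Affine functions with nonnegative endpoint values** are Bernstein-positive of degree `1`. [folklore] -/
theorem bernsteinPos_affine {x y : ℝ} (hx : 0 ≤ x) (hy : 0 ≤ y) : BernsteinPos 1 (fun h => (1 - h) * x + h * y) :=
  ((bernsteinPos_one_sub.smul hx).add (bernsteinPos_id.smul hy)).congr fun h _ _ => by ring

/-- `h^a (1−h)^b` is Bernstein-positive of degree `a + b`. [folklore] -/
theorem bernsteinPos_pow (a b : ℕ) : BernsteinPos (a + b) (fun h => h ^ a * (1 - h) ^ b) := by
  induction a with
  | zero =>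
    induction b with
    | zero => exact (bernsteinPos_const 0 zero_le_one).congr fun h _ _ => by simp
    | succ b ih =>
      exact ((ih.mul bernsteinPos_one_sub).mono (by omega)).congr fun h _ _ => by ring
  | succ a ih =>
    exact ((ih.mul bernsteinPos_id).mono (by omega)).congr fun h _ _ => by ring

/-! ### The coin: product weight on `α × Bool`, its moments, the OR- and AND-mixture events -/

section Coin

variable {α : Type*} [Fintype α]

/-- The product of the weight `μ` with an independent coin of bias `h`: `(a, ξ) ↦ μ(a)·(h if ξ else 1 − h)`. [folklore] -/
def coinWeight (μ : α → ℝ) (h : ℝ) : α × Bool → ℝ := fun x => μ x.1 * (bif x.2 then h else 1 - h)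

/-- **Coin moments are affine in the bias**: `E_{μ⊗coin(h)}[g] = (1−h)·E_μ[g(·,false)] + h·E_μ[g(·,true)]`. [folklore] -/
theorem ex_coinWeight (μ : α → ℝ) (h : ℝ) (g : α × Bool → ℝ) :
    ex (coinWeight μ h) g = (1 - h) * ex μ (fun a => g (a, false)) + h * ex μ (fun a => g (a, true)) := by
  simp only [ex_def, coinWeight, Fintype.sum_prod_type, Fintype.sum_bool, cond_true, cond_false, Finset.mul_sum,
    ← Finset.sum_add_distrib]
  exact Finset.sum_congr rfl fun a _ => by ring

omit [Fintype α] in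
/-- The coin weight is nonnegative for `h ∈ [0,1]`. [folklore] -/
theorem coinWeight_nonneg {μ : α → ℝ} (hμ : ∀ a, 0 ≤ μ a) {h : ℝ} (h0 : 0 ≤ h) (h1 : h ≤ 1) (x : α × Bool) :
    0 ≤ coinWeight μ h x := by
  unfold coinWeight
  cases x.2
  · exact mul_nonneg (hμ _) (by simpa using sub_nonneg.2 h1)
  · exact mul_nonneg (hμ _) (by simpa using h0)

/-- The coin weight has total mass `1`. [folklore] -/
theorem sum_coinWeight {μ : α → ℝ} (hμ1 : ∑ a, μ a = 1) (h : ℝ) : ∑ x, coinWeight μ h x = 1 := by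
  have h1 : ∑ x, coinWeight μ h x = ex (coinWeight μ h) (fun _ => 1) := by simp [ex_def]
  rw [h1, ex_coinWeight]
  simp only [ex_def, mul_one, hμ1]
  ring

/-- **Coin moments of nonnegative functions are Bernstein-positive of degree `1`** (affine with nonnegative endpoint values). [this work] -/
theorem bernsteinPos_ex_coinWeight {μ : α → ℝ} (hμ : ∀ a, 0 ≤ μ a) {g : α × Bool → ℝ} (hg : ∀ x, 0 ≤ g x) :
    BernsteinPos 1 (fun h => ex (coinWeight μ h) g) :=
  (bernsteinPos_affine (ex_nonneg hμ fun a => hg (a, false)) (ex_nonneg hμ fun a => hg (a, true))).congr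
    fun h _ _ => ex_coinWeight μ h g

/-- `c − E_{μ⊗coin(h)}[g]` is Bernstein-positive of degree `1` whenever `g ≤ 1 ≤ c` pointwise and `μ` is a probability weight. [this work] -/
theorem bernsteinPos_const_sub_ex_coinWeight {μ : α → ℝ} (hμ : ∀ a, 0 ≤ μ a) (hμ1 : ∑ a, μ a = 1) {g : α × Bool → ℝ}
    (hg : ∀ x, g x ≤ 1) {c : ℝ} (hc : 1 ≤ c) : BernsteinPos 1 (fun h => c - ex (coinWeight μ h) g) := by
  have hle : ∀ b : Bool, ex μ (fun a => g (a, b)) ≤ 1 := fun b =>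
    (ex_mono hμ fun a => hg (a, b)).trans_eq (ex_const hμ1 1)
  refine (bernsteinPos_affine (sub_nonneg.2 ((hle false).trans hc)) (sub_nonneg.2 ((hle true).trans hc))).congr
    fun h _ _ => ?_
  rw [ex_coinWeight]; ring

/-- OR-ing the coin event into `A` (if `b`): the event `{(a, ξ) | a ∈ A ∨ (b ∧ ξ)}` of `α × Bool`. [this work] -/
def orCoin (A : Set α) (b : Bool) : Set (α × Bool) := {x | x.1 ∈ A ∨ (b = true ∧ x.2 = true)}

/-- AND-ing the coin event into `A` (if `b`): the event `{(a, ξ) | a ∈ A ∧ (b → ξ)}` of `α × Bool`. [this work] -/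
def andCoin (A : Set α) (b : Bool) : Set (α × Bool) := {x | x.1 ∈ A ∧ (b = true → x.2 = true)}

omit [Fintype α] in
/-- Off the coin, the OR-mixture event is `A`. [this work] -/
@[simp] theorem ind_orCoin_false (A : Set α) (b : Bool) (a : α) : ind (orCoin A b) (a, false) = ind A a := by
  by_cases ha : a ∈ A <;> simp [orCoin, ind_of_mem, ind_of_not_mem, ha]

omit [Fintype α] in
/-- On the coin, the OR-mixture event is `A` or everything. [this work] -/
@[simp] theorem ind_orCoin_true (A : Set α) (b : Bool) (a : α) :
    ind (orCoin A b) (a, true) = bif b then 1 else ind A a := by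
  cases b <;> by_cases ha : a ∈ A <;> simp [orCoin, ind_of_mem, ind_of_not_mem, ha]

omit [Fintype α] in
/-- On the coin, the AND-mixture event is `A`. [this work] -/
@[simp] theorem ind_andCoin_true (A : Set α) (b : Bool) (a : α) : ind (andCoin A b) (a, true) = ind A a := by
  by_cases ha : a ∈ A <;> simp [andCoin, ind_of_mem, ind_of_not_mem, ha]

omit [Fintype α] in
/-- Off the coin, the AND-mixture event is `A` or nothing. [this work] -/
@[simp] theorem ind_andCoin_false (A : Set α) (b : Bool) (a : α) :
    ind (andCoin A b) (a, false) = bif b then 0 else ind A a := by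
  cases b <;> by_cases ha : a ∈ A <;> simp [andCoin, ind_of_mem, ind_of_not_mem, ha]

end Coin

/-! ### The conjecture -/

/-- A finite family of events is **Sahi-nonnegative at every order**: `E_m(μ; 1_{A_{s 0}},…,1_{A_{s (m−1)}}) ≥ 0` for every multiset of
members (every slot map `s : Fin m → Fin n`, every `m`). [this work] -/
def AllOrders {α : Type*} [Fintype α] (μ : α → ℝ) {n : ℕ} (A : Fin n → Set α) : Prop :=
  ∀ (m : ℕ) (s : Fin m → Fin n), 0 ≤ sahiE μ m (fun j => ind (A (s j)))

/-- **THE MIXTURE CONJECTURE (law level)** (this seat, gen 4; HIERARCHY.md §11 UPDATE): for every probability weight `μ` on a finite type,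
every family of events `A_0,…,A_{n−1}` that is Sahi-nonnegative at every order, every `F : Fin n → Bool` and every multiset of members
`s : Fin m → Fin n`, the functionals `h ↦ E_m(μ ⊗ coin(h); 1_{B_{s j}})` of the OR-mixture `B_i = A_i ∪ [F i]·{coin}` and of the
AND-mixture `B_i = A_i ∩ ([F i] → {coin})` are BERNSTEIN-POSITIVE of degree `m` in the bias `h` (in particular the mixed families are
again Sahi-nonnegative at every order).  THEOREM for `n ≤ 3` (`…SahiMixtureLawThree`); equivalent to its square-free cells
(`mixtureBernsteinPositivity_iff_squarefree`); OPEN for `n ≥ 4` (exhaustive grid census at `n = 3`, ttrl cp-mix: 0 negative coefficients in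
1.1·10⁸ tests).  An obligation of our theories, never a fact: use as `(h : MixtureBernsteinPositivity)`. [status: open] -/
@[conjecture] def MixtureBernsteinPositivity : Prop :=
  ∀ (α : Type) [Fintype α] (μ : α → ℝ), (∀ a, 0 ≤ μ a) → ∑ a, μ a = 1 →
    ∀ (n : ℕ) (A : Fin n → Set α) (F : Fin n → Bool), AllOrders μ A →
      ∀ (m : ℕ) (s : Fin m → Fin n),
        BernsteinPos m (fun h => sahiE (coinWeight μ h) m (fun j => ind (orCoin (A (s j)) (F (s j))))) ∧
        BernsteinPos m (fun h => sahiE (coinWeight μ h) m (fun j => ind (andCoin (A (s j)) (F (s j)))))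

/-! ### Range lifting: reduction to the square-free cells -/

section RangeLifting

variable {α : Type*} [Fintype α]

/-- Slot maps out of `Fin 0` and `Fin 1` are injective. [folklore] -/
theorem injective_of_le_one {m n : ℕ} (hm : m ≤ 1) (s : Fin m → Fin n) : Injective s := by
  intro a b _
  have : Subsingleton (Fin m) := by
    rcases Nat.le_one_iff_eq_zero_or_eq_one.1 hm with rfl | rfl <;> infer_instance
  exact Subsingleton.elim a b

/-- A non-injective slot map on `Fin (k+2)`, after a transposition, repeats its head value somewhere in the tail. [folklore] -/
theorem exists_swap_head_repeat {k n : ℕ} {s : Fin (k + 2) → Fin n} (hs : ¬ Injective s) :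
    ∃ (σ : Equiv.Perm (Fin (k + 2))) (c : Fin (k + 1)), s (σ 0) = s (σ c.succ) := by
  obtain ⟨a, b, hab, hne⟩ : ∃ a b, s a = s b ∧ a ≠ b := by
    simpa [Injective, not_forall] using hs
  refine ⟨Equiv.swap 0 a, (Equiv.swap 0 a b).pred ?_, ?_⟩
  · intro h0
    have : b = a := by
      have := congrArg (Equiv.swap 0 a) h0
      simpa using this
    exact hne this.symm
  · simp only [Equiv.swap_apply_left, Fin.succ_pred, Equiv.swap_apply_self]
    exact hab

/-- **RANGE LIFTING (law level).**  Let `B_0,…,B_{n−1}` be ANY events of `α × Bool` and `μ` a probability weight on `α`.  If for every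
INJECTIVE slot map `s : Fin m → Fin n` the functional `h ↦ E_m(μ ⊗ coin(h); 1_{B_{s 0}},…,1_{B_{s (m−1)}})` is Bernstein-positive of degree
`m`, then it is for EVERY slot map (every multiset of members).  A repeated member contains the intersection of the others, so in the defect
expansion (`SahiDefectExpansion.sahiE_cons_eq_defect_expansion`, any weight) the top defect vanishes and every other term is a product of
coin-moments of nonnegative functions (affine in `h`, nonnegative endpoints) and lower-order functionals of sub-multisets; strong induction
on `m`. [this work] -/
theorem bernsteinPos_sahiE_of_injective {μ : α → ℝ} (hμ : ∀ a, 0 ≤ μ a) (hμ1 : ∑ a, μ a = 1) {n : ℕ}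
    (B : Fin n → Set (α × Bool))
    (hinj : ∀ (m : ℕ) (s : Fin m → Fin n), Injective s →
      BernsteinPos m (fun h => sahiE (coinWeight μ h) m (fun j => ind (B (s j))))) :
    ∀ (m : ℕ) (s : Fin m → Fin n), BernsteinPos m (fun h => sahiE (coinWeight μ h) m (fun j => ind (B (s j)))) := by
  intro m
  induction m using Nat.strong_induction_on with
  | _ m ih =>
    intro s
    by_cases hs : Injective s
    · exact hinj m s hs
    obtain ⟨k, rfl⟩ : ∃ k, m = k + 2 := ⟨m - 2, by
      have : ¬ m ≤ 1 := fun h => hs (injective_of_le_one h s)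
      omega⟩
    obtain ⟨σ, c, hc⟩ := exists_swap_head_repeat hs
    -- the family after the transposition, as head :: tail
    set d : α × Bool → ℝ := ind (B (s (σ 0))) with hd
    set g : Fin (k + 1) → α × Bool → ℝ := fun i => ind (B (s (σ i.succ))) with hg
    have hperm : ∀ h : ℝ, sahiE (coinWeight μ h) (k + 2) (fun j => ind (B (s j)))
        = sahiE (coinWeight μ h) (k + 2) (Fin.cons d g : Fin (k + 2) → α × Bool → ℝ) := fun h => by
      rw [← sahiE_comp_perm (coinWeight μ h) (k + 2) σ (fun j => ind (B (s j)))]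
      congr 1
      funext j
      refine Fin.cases ?_ (fun i => ?_) j
      · simp [hd]
      · simp [hg]
    -- pointwise facts about the indicators
    have hg0 : ∀ i x, 0 ≤ g i x := fun i x => ind_nonneg _ _
    have hg1 : ∀ i x, g i x ≤ 1 := fun i x => Literature.Probability.Percolation.BHK2006.ind_le_one _ _
    have hd1 : ∀ x, d x ≤ 1 := fun x => Literature.Probability.Percolation.BHK2006.ind_le_one _ _
    have hdef0 : ∀ (T : Finset (Fin (k + 1))) (x : α × Bool), 0 ≤ ((1 - d) * ∏ i ∈ T, g i) x := fun T x => by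
      simp only [Pi.mul_apply, Pi.sub_apply, Pi.one_apply, Finset.prod_apply]
      exact mul_nonneg (sub_nonneg.2 (hd1 x)) (Finset.prod_nonneg fun i _ => hg0 i x)
    -- the top defect vanishes: the head is repeated in the tail
    have htop : ((1 - d) * ∏ i, g i) = 0 := by
      funext x
      simp only [Pi.mul_apply, Pi.sub_apply, Pi.one_apply, Finset.prod_apply, Pi.zero_apply]
      rw [← Finset.mul_prod_erase _ _ (Finset.mem_univ c)]
      have hgc : g c x = d x := by simp [hg, hd, hc]
      rw [hgc]
      by_cases hx : x ∈ B (s (σ 0))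
      · simp [hd, ind_of_mem hx]
      · simp [hd, ind_of_not_mem hx]
    -- sub-multisets are Bernstein-positive by induction
    have hsub : ∀ T : Finset (Fin (k + 1)), BernsteinPos Tᶜ.card
        (fun h => sahiE (coinWeight μ h) Tᶜ.card (fun j => g (Tᶜ.orderEmbOfFin rfl j))) := fun T => by
      have hlt : Tᶜ.card < k + 2 := lt_of_le_of_lt (Finset.card_le_univ _) (by simp)
      exact ih _ hlt (fun j => s (σ (Tᶜ.orderEmbOfFin rfl j).succ))
    have htail : BernsteinPos (k + 1) (fun h => sahiE (coinWeight μ h) (k + 1) g) :=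
      ih _ (by omega) (fun i => s (σ i.succ))
    -- assemble the defect expansion
    have hhead : BernsteinPos 1 (fun h => ((k : ℝ) + 1) - ex (coinWeight μ h) d) :=
      bernsteinPos_const_sub_ex_coinWeight hμ hμ1 hd1 (by
        have : (0 : ℝ) ≤ k := Nat.cast_nonneg k
        linarith)
    have hterms : BernsteinPos (k + 2) (fun h =>
        ∑ T : Finset (Fin (k + 1)) with (T.Nonempty ∧ T ≠ univ),
          ((T.card)! : ℝ) * (ex (coinWeight μ h) ((1 - d) * ∏ i ∈ T, g i)
            * sahiE (coinWeight μ h) Tᶜ.card (fun j => g (Tᶜ.orderEmbOfFin rfl j)))) := by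
      refine BernsteinPos.sum _ fun T hT => ?_
      have hT' := (Finset.mem_filter.1 hT).2
      have hcard : 1 + Tᶜ.card ≤ k + 2 := by
        have h1 : Tᶜ.card ≤ k + 1 := (Finset.card_le_univ _).trans (by simp)
        omega
      exact ((bernsteinPos_ex_coinWeight hμ (hdef0 T)).mul_of_le (hsub T) hcard).smul (Nat.cast_nonneg _)
    have hall := ((hhead.mul_of_le htail (by omega)).add hterms)
    refine hall.congr fun h _ _ => ?_
    rw [hperm h, SahiDefectExpansion.sahiE_cons_eq_defect_expansion (coinWeight μ h) k d g, htop]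
    simp [ex_def]

/-- The conjecture for ONE family and ONE mixture kind, as a predicate (used to state the square-free reduction). [this work] -/
def MixCells {α : Type*} [Fintype α] (μ : α → ℝ) {n : ℕ} (B : Fin n → Set (α × Bool))
    (P : ∀ m : ℕ, (Fin m → Fin n) → Prop) : Prop :=
  ∀ (m : ℕ) (s : Fin m → Fin n), P m s → BernsteinPos m (fun h => sahiE (coinWeight μ h) m (fun j => ind (B (s j))))

/-- **Square-free reduction**: Bernstein positivity of all cells of a family of coin-space events is equivalent to that of its square-free
cells (injective slot maps, hence `m ≤ n`). [this work] -/
theorem mixCells_iff_squarefree {μ : α → ℝ} (hμ : ∀ a, 0 ≤ μ a) (hμ1 : ∑ a, μ a = 1) {n : ℕ} (B : Fin n → Set (α × Bool)) :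
    MixCells μ B (fun _ _ => True) ↔ MixCells μ B (fun _ s => Injective s) :=
  ⟨fun h m s _ => h m s trivial, fun h m s _ => bernsteinPos_sahiE_of_injective hμ hμ1 B (fun m s hs => h m s hs) m s⟩

/-- **THE MIXTURE CONJECTURE ⟺ ITS SQUARE-FREE CELLS**: it suffices to treat injective slot maps `s : Fin m → Fin n` (so `m ≤ n`), for both
mixture kinds. [this work] -/
theorem mixtureBernsteinPositivity_iff_squarefree :
    MixtureBernsteinPositivity ↔
      ∀ (α : Type) [Fintype α] (μ : α → ℝ), (∀ a, 0 ≤ μ a) → ∑ a, μ a = 1 →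
        ∀ (n : ℕ) (A : Fin n → Set α) (F : Fin n → Bool), AllOrders μ A →
          ∀ (m : ℕ) (s : Fin m → Fin n), Injective s →
            BernsteinPos m (fun h => sahiE (coinWeight μ h) m (fun j => ind (orCoin (A (s j)) (F (s j))))) ∧
            BernsteinPos m (fun h => sahiE (coinWeight μ h) m (fun j => ind (andCoin (A (s j)) (F (s j))))) := by
  constructor
  · intro h α _ μ hμ hμ1 n A F hA m s _
    exact h α μ hμ hμ1 n A F hA m s
  · intro h α _ μ hμ hμ1 n A F hA m s
    exact ⟨bernsteinPos_sahiE_of_injective hμ hμ1 (fun i => orCoin (A i) (F i)) (fun m s hs => (h α μ hμ hμ1 n A F hA m s hs).1) m s,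
      bernsteinPos_sahiE_of_injective hμ hμ1 (fun i => andCoin (A i) (F i)) (fun m s hs => (h α μ hμ hμ1 n A F hA m s hs).2) m s⟩

/-- Consequence of a cell: the mixed family is Sahi-nonnegative for every bias `h ∈ [0,1]`. [this work] -/
theorem sahiE_coinWeight_nonneg_of_bernsteinPos {μ : α → ℝ} {n m : ℕ} {B : Fin n → Set (α × Bool)} {s : Fin m → Fin n}
    (hB : BernsteinPos m (fun h => sahiE (coinWeight μ h) m (fun j => ind (B (s j))))) {h : ℝ} (h0 : 0 ≤ h) (h1 : h ≤ 1) :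
    0 ≤ sahiE (coinWeight μ h) m (fun j => ind (B (s j))) :=
  hB.nonneg h0 h1

end RangeLifting

end SahiMixture

end Summit.CriticalPhenomena.PercolationContinuityZ3.Theorems

end
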